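import Summits.AnomalousDissipation.AnomalousDissipation.Theorems.SolenoidalFractalHomogenisationLagrangianStepCellChainRegimeTools
import Summits.AnomalousDissipation.AnomalousDissipation.Theorems.SolenoidalFractalHomogenisationLagrangianStepOneLevelSplitDefsW7Frame
import HarnessLib

/-!
# K1L_D (stmt-AnomalousDissipation-27980), (ℓ3) (D-TH)₀ — the `k̃`-SPLICE of the frozen-frame per-class clause `ClassDecayWθ`
# (helper; `--supports stmt-AnomalousDissipation-27980 --as helper`)

Port plan B11 (`HOME/ad-sawtooth-k1loc-p1/g16/W7thg-portplan-k1locp1g16.md`; prover ad-sawtooth-k1loc-p1 g16): the frozen-frame twin of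
`CellChain.classDecayW_split_kt` (`…CellChainRegimeTools` §2).  The lattice geometry of §1 of that file (`norm_latticeVec_ge_of_classPair_ne`,
`windows_disjoint_of_two_norm_lt`) is frame-free and reused BY NAME by the frozen assembly; only the splice mentions the clause and is twinned here:
near classes (`∃ z, ‖ℓ + nz‖ < κn`, the twisted engine `classDecayWθ_chain`) + far classes (`∀ z, κn ≤ ‖ℓ + nz‖`, bare dissipation `classDecayWθ_bare`, p729441)
give ALL classes at the fixed frame `G₀`, constants `max CK`, `min cK`, `min ν₀`.
* `classDecayWθ_split_kt`.
No definitions, no sorry.  NOT a proof of `stub_W7thg`, of K1L_D or of AD; rung F-D1.A0.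
[cite: BedrossianCotiZelati2017, Thm 1.1 — bookkeeping of this route's graded W7 clause] [problem: turb]
-/

set_option linter.dupNamespace false

noncomputable section

namespace Summit.AnomalousDissipation.AnomalousDissipation.Theorems.SolenoidalFractalHomogenisation.LagrangianStep.CellChain

open Set MeasureTheory
open Literature.Analysis Literature.Analysis.FunctionSpaces Literature.Analysis.FunctionSpaces.Torus
open Literature.Analysis.FluidPDE Literature.Analysis.FluidPDE.Torus Literature.Analysis.FluidPDE.LatticeShear
open Summit.AnomalousDissipation.AnomalousDissipation.Theorems.SolenoidalFractalHomogenisation.LagrangianStep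

/-- **SPLICE in the ν-free label distance, frozen frame**: near classes (`∃ z, ‖ℓ + nz‖ < κn`) and far classes (`∀ z, κn ≤ ‖ℓ + nz‖`) together give
all classes at the fixed frame `G₀`, with constants `max CK`, `min cK`, `min ν₀`. [cite: BedrossianCotiZelati2017, Thm 1.1 — bookkeeping of this route's graded W7 clause] -/
theorem classDecayWθ_split_kt {G₀ : Matrix (Fin 3) (Fin 3) ℝ} {k : ℕ} {W : LatticeWord k} {M : ℝ} {hM : 0 < M}
    {lo hi Λ β ν₁ ν₂ Kb CK₁ CK₂ cK₁ cK₂ : ℝ} (κ : ℝ) (hCK₁ : 0 ≤ CK₁)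
    (h₁ : ClassDecayWθ G₀ W M hM lo hi Λ β ν₁ Kb CK₁ cK₁ (fun n _ ℓ => ∃ z : Fin 3 → ℤ, ‖Torus.latticeVec (ℓ + (n : ℤ) • z)‖ < κ * n))
    (h₂ : ClassDecayWθ G₀ W M hM lo hi Λ β ν₂ Kb CK₂ cK₂ (fun n _ ℓ => ∀ z : Fin 3 → ℤ, κ * n ≤ ‖Torus.latticeVec (ℓ + (n : ℤ) • z)‖)) :
    ClassDecayWθ G₀ W M hM lo hi Λ β (min ν₁ ν₂) Kb (max CK₁ CK₂) (min cK₁ cK₂) admAll := by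
  intro ν hν n hn 𝔸 hodd hwin L hL hKL ℓ hdist _ F hF1 hF2 hF3 hsupp T hT u hu
  have hCK0 : 0 ≤ max CK₁ CK₂ := le_max_of_le_left hCK₁
  by_cases hc : ∃ z : Fin 3 → ℤ, ‖Torus.latticeVec (ℓ + (n : ℤ) • z)‖ < κ * n
  · have h₁' := classDecayWθ_mono (adm' := fun n _ ℓ => ∃ z : Fin 3 → ℤ, ‖Torus.latticeVec (ℓ + (n : ℤ) • z)‖ < κ * n)
      (min_le_left ν₁ ν₂) (le_max_left CK₁ CK₂) (min_le_left cK₁ cK₂) hCK0 (fun _ _ _ h => h) h₁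
    exact h₁' ν hν n hn 𝔸 hodd hwin L hL hKL ℓ hdist hc F hF1 hF2 hF3 hsupp T hT u hu
  · have hfar : ∀ z : Fin 3 → ℤ, κ * n ≤ ‖Torus.latticeVec (ℓ + (n : ℤ) • z)‖ := by
      intro z
      by_contra hz
      exact hc ⟨z, not_le.mp hz⟩
    have h₂' := classDecayWθ_mono (adm' := fun n _ ℓ => ∀ z : Fin 3 → ℤ, κ * n ≤ ‖Torus.latticeVec (ℓ + (n : ℤ) • z)‖)
      (min_le_right ν₁ ν₂) (le_max_right CK₁ CK₂) (min_le_right cK₁ cK₂) hCK0 (fun _ _ _ h => h) h₂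
    exact h₂' ν hν n hn 𝔸 hodd hwin L hL hKL ℓ hdist hfar F hF1 hF2 hF3 hsupp T hT u hu

end Summit.AnomalousDissipation.AnomalousDissipation.Theorems.SolenoidalFractalHomogenisation.LagrangianStep.CellChain

end
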